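import Literature.NumberTheory.EllipticCurves.Kato2004.DivisibilityInputsExceptionalTransportProofs
import HarnessLib

/-!
# Kato 2004 §17.13 with an exceptional height-one prime inside the `p`-adic `L`-function, LENGTH form of the
# transport hypothesis: `ℓ_{𝔮₀}(X) ≤ ℓ_{𝔮₀}(Λ/(L̃₀))` at the factor's prime from the symmetry
# `ℓ_{𝔮₀}(X) = ℓ_{ι𝔮₀}(X)` of the ONE pair of lengths (instead of `ι(char X) = char X`) — PROVED module theory
# (sequel of `DivisibilityInputsExceptionalTransportProofs`)

K. Kato, Astérisque **295** (2004) [Kato2004Asterisque], Thm. 12.5 (3) with (12.5.1) (p. 222), §17.13 (pp. 279–280).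
`MultDivisibilityInputs.lengthAt_X_le_at_factor_of_transport` (companion file) asks for Greenberg's `ι(char X) = char X`
in IDEAL form and reads it prime by prime; when the symmetry of `X` is only available at the one pair of primes
`(𝔮₀, ι𝔮₀)` — e.g. obtained from the symmetry of two other modules by additivity of lengths in a `Δ`-eigen-
decomposition (`Module.lengthAt_eq_add_of_involution`) — the same conclusion holds:
`MultDivisibilityInputs.lengthAt_X_le_at_factor_of_lengthAt_symm`. THEOREMS ONLY (no definition, no named fact,
no instance, no `sorry`); `Kato2004.thm12_4` is a hypothesis as in the companion file.

References: [Kato2004Asterisque] Thm. 12.4 (2) (p. 221), Thm. 12.5 (3) and (12.5.1) (p. 222), Conj. 17.6 (p. 274),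
§17.13 (pp. 279–280); [GreenbergLNM1716] Thm. 1.14 (p. 68); [MazurTateTeitelbaum1986Invent] §I.17.
-/

noncomputable section

open scoped Classical

namespace Literature.NumberTheory.EllipticCurves.Kato2004

open Module Field Literature.NumberTheory.EllipticCurves.IwasawaAlgebra
  Literature.NumberTheory.EllipticCurves.Module

variable {W : WeierstrassCurve ℚ} [W.IsElliptic] {p : ℕ} [Fact p.Prime]
  [ContinuousSMul ℤ_[p] (W.tateModule p)] {κ : ZpExtension ℚ p} {γ : absoluteGaloisGroup ℚ}
  {I : IwasawaH1Data W p κ γ} {D : W.SelmerDualData κ γ}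

/-- **`ℓ_{𝔮₀}(X) ≤ ℓ_{𝔮₀}(Λ/(L̃₀))` AT the factor's prime, LENGTH form of the transport hypothesis.** Package
`K : MultDivisibilityInputs W p (ι(π)·L₀) κ γ I D`, integral `L̃₀ ≠ 0` with `ι L̃₀ = p^m·L₀`, `thm12_4`; a height-one
`𝔮₀ ∌ p` with `π ∉ ι𝔮₀`; the symmetry `ℓ_{𝔮₀}(D.X) = ℓ_{ι𝔮₀}(D.X)` of the one pair of lengths; and
`(ι L̃₀) = (L̃₀)` (functional equation). Then Conj. 17.6's inequality holds at `𝔮₀`. (Same proof as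
`lengthAt_X_le_at_factor_of_transport`, with the prime-by-prime reading of Greenberg's theorem replaced by the
hypothesis.) [cite: Kato2004Asterisque, Thm. 12.5 (3) and (12.5.1) (p. 222), Conj. 17.6 (p. 274), §17.13 (pp. 279–280)]
[cite: GreenbergLNM1716, Thm. 1.14 (p. 68)] [cite: MazurTateTeitelbaum1986Invent, §I.17] -/
theorem MultDivisibilityInputs.lengthAt_X_le_at_factor_of_lengthAt_symm (h12 : thm12_4)
    (hκ : κ.IsCyclotomic) (hγ : κ.IsTopGenerator γ) {π : IwasawaAlgebra p} {L₀ : PowerSeries ℚ_[p]}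
    (K : MultDivisibilityInputs W p (iwasawaToPowerSeries p π * L₀) κ γ I D)
    {Lt : IwasawaAlgebra p} {m : ℕ}
    (hLt : iwasawaToPowerSeries p Lt = PowerSeries.C ((p : ℚ_[p]) ^ m) * L₀) (hLt0 : Lt ≠ 0)
    (𝔮₀ : PrimeSpectrum (IwasawaAlgebra p)) (h𝔮₀ : 𝔮₀.asIdeal.height = 1)
    (hp𝔮₀ : PowerSeries.C (p : ℤ_[p]) ∉ 𝔮₀.asIdeal)
    (hπ : π ∉ (PrimeSpectrum.comap (invol p).toRingHom 𝔮₀).asIdeal)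
    (hXsym : lengthAt (IwasawaAlgebra p) D.X 𝔮₀ =
      lengthAt (IwasawaAlgebra p) D.X (PrimeSpectrum.comap (invol p).toRingHom 𝔮₀))
    (hLtι : (Ideal.span {Lt}).map (invol p).toRingHom = Ideal.span {Lt}) :
    lengthAt (IwasawaAlgebra p) D.X 𝔮₀ ≤
      lengthAt (IwasawaAlgebra p) (IwasawaAlgebra p ⧸ Ideal.span {Lt}) 𝔮₀ := by
  set 𝔮' := PrimeSpectrum.comap (invol p).toRingHom 𝔮₀ with h𝔮'def
  have h𝔮' : 𝔮'.asIdeal.height = 1 := by rw [h𝔮'def, height_comap_invol]; exact h𝔮₀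
  have hp𝔮' : PowerSeries.C (p : ℤ_[p]) ∉ 𝔮'.asIdeal := by
    intro h
    apply hp𝔮₀
    rw [h𝔮'def, PrimeSpectrum.comap_asIdeal, Ideal.mem_comap] at h
    change invol p (PowerSeries.C (p : ℤ_[p])) ∈ 𝔮₀.asIdeal at h
    rwa [invol_C] at h
  have hA := K.lengthAt_X_le_off_factor h12 hκ hγ hLt hLt0 𝔮' h𝔮' hp𝔮' hπ
  rw [hXsym, lengthAt_quotient_span_eq_comap_invol_of_map_invol_span_eq hLtι 𝔮₀]
  exact hA

end Literature.NumberTheory.EllipticCurves.Kato2004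

end
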